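import Summits.ResolutionOfSingularities.ResolutionOfSingularities.Theorems.FrobeniusLadderFRationalResolutionGaloisUpstairsPiece
import Mathlib.RingTheory.Unramified.Field
import Mathlib.RingTheory.FiniteStability
import HarnessLib

/-!
# Crux `FrobeniusLadder.FRationalResolution` (stmt-ResolutionOfSingularities-15317), line `redirect`,
# stub `stub_diagonalizableQuotientResolution` — the fibre of `B ⊗_K K'` over a closed point of `B` is REDUCED at each of its points
# (`K'/K` separable): the hypothesis `hred` of `…GaloisUpstairsPiece.exists_piece_of_residue_embedding` for the Galois base change

* `formallyUnramified_baseChange` — `B → B ⊗_K K'` is formally unramified for `K'/K` finite separable;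
* **`map_eq_maximalIdeal_baseChange`** — for `𝔭 ⊆ B` maximal and `𝔔'` a prime of `B ⊗_K K'` over `𝔭`:
  `𝔭 (B ⊗_K K')_{𝔔'} = 𝔔' (B ⊗_K K')_{𝔔'}`.

Honest label: generic plumbing (no stub closed by name). No definitions, no named facts, no sorry.
[cite: StacksProject, Tag 02G8; Tag 09H0]
-/

noncomputable section

-- single-problem summit: the doubled namespace component is forced
set_option linter.dupNamespace false

open TensorProduct

namespace Summit.ResolutionOfSingularities.ResolutionOfSingularities.Theorems.FRationalResolution.GaloisFibreUnramified

/-- `B → B ⊗_K K'` is formally unramified for `K'/K` separable (base change of a formally unramified field extension).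
[cite: StacksProject, Tag 09H0] -/
theorem formallyUnramified_baseChange (K K' B : Type) [Field K] [Field K'] [Algebra K K'] [Algebra.IsSeparable K K']
    [CommRing B] [Algebra K B] : Algebra.FormallyUnramified B (B ⊗[K] K') := by
  haveI : Algebra.FormallyUnramified K K' := Algebra.FormallyUnramified.of_isSeparable K K'
  infer_instance

/-- **The fibre of `B ⊗_K K'` over a closed point is reduced at each of its points** (`K'/K` finite separable): for `𝔭 ⊆ B`
maximal and a prime `𝔔' ⊆ B ⊗_K K'` over `𝔭`, `𝔭 (B ⊗_K K')_{𝔔'}` is the maximal ideal. [cite: StacksProject, Tag 02G8] -/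
theorem map_eq_maximalIdeal_baseChange (K K' B : Type) [Field K] [Field K'] [Algebra K K'] [FiniteDimensional K K']
    [Algebra.IsSeparable K K'] [CommRing B] [Algebra K B] (𝔭 : Ideal B) [𝔭.IsMaximal] (𝔔' : Ideal (B ⊗[K] K'))
    [𝔔'.IsPrime] (h𝔔' : 𝔔'.comap (algebraMap B (B ⊗[K] K')) = 𝔭) :
    𝔭.map (algebraMap B (Localization.AtPrime 𝔔')) = IsLocalRing.maximalIdeal (Localization.AtPrime 𝔔') := by
  haveI := formallyUnramified_baseChange K K' B
  haveI : Algebra.FiniteType B (B ⊗[K] K') := inferInstance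
  exact GaloisUpstairsPiece.map_eq_maximalIdeal_of_formallyUnramified 𝔭 𝔔' h𝔔'

end Summit.ResolutionOfSingularities.ResolutionOfSingularities.Theorems.FRationalResolution.GaloisFibreUnramified

end
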